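import Literature.MathematicalPhysics.QuantumLattice.HubbardNNNHoppingWindowCertificateD4

/-!
# `wardk` — shared DEFINITIONS of the line (sorry-free; imported by both Lines files and by stub proofs)

Line `wardk` for the cruxes `M3PrimeEdgeSplit.LowerEdge_ge_m4o5` (item stmt-Ventures-21721) and its
`−83/100` twin `M3x2EdgeSplit.LowerEdge_ge_m83o100` (stmt-Ventures-22024): SU(2)-Ward × affine-`D₄` window
certificates, cut for provers through a GENERIC-SECTOR torus certificate theorem.  Team lb-sym (symmetry
reduction), pen hub-lb-sym-plan-2 (captain's call 2026-08-28T05:40:12Z; co-author dual-plan-1; importer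
sym-plan-1).  This module holds ONLY definitions and one sorry-free composition lemma — the INTENDED single
home of the line's statements, importable without importing any `sorry`.

STATUS 2026-08-28T06:30Z (read before importing): the two REGISTERED skeletons `Lines/wardk.lean` (this crux
dir and `Cruxes/LowerEdge_ge_m83o100/Lines/wardk.lean`) are SELF-CONTAINED verbatim copies of these
definitions (same namespace, same names, same text), because crux workfiles reach the farm's import path only
after the gate build backlog (hours: `lean check` of an importing file answers rc 75
`remote:stale:…:unbuilt:…Lines.wardk_defs`).  Never import this module together with a `Lines/wardk.lean`
(duplicate declarations).  A prover who wants a sorry-free import TODAY lands this file verbatim as a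
definition proposal `Summits/Ventures/CertifiedManyBodySolver/Theorems/M3PrimeEdgeSplitWardKDefs.lean`
(namespace moved under `Summit.Ventures.CertifiedManyBodySolver.Theorems.…` as the gate requires;
`--supports stmt-Ventures-21721`) and states each stub `theorem <StubName> : <signature>` against it inside
`namespace Summit.Ventures.CertifiedManyBodySolver.Cruxes.LowerEdge_ge_m4o5.WardK` with that namespace
`open`ed — the registered signature TEXT is unchanged, which is what `--supports` matching reads.  The v2
skeletons that import this module directly are in the pen's folder and swap in once the module is built.

The Lean debt of the symmetry-reduction lens is ONE missing null family: every certificate of record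
(CORE #294, MENU #529, the F3′a members) carries SU(2) Ward equality rows `ω([S^±_tot, X]) = 0`, while the
tree's soundness theorem `energyDensityTT'_ge_of_window_certificate_d4` has no Ward slot (its generic
engine `torus_minEnergyOn_div_ge_of_local_certificate` hard-codes the sector `szSector (2n) 0`, which
`S^±` do not preserve and in which Ward rows FAIL for ground multiplets of spin `S ≥ 1` — exact 4×4
witness: hub-lb-dual-ref-2, `ward_szsector_witness.md`, evidence on stmt-Ventures-22024).  The cut:

* `GenericSectorTorusCert` (W1) — `torus_minEnergyOn_div_ge_of_local_certificate` with the sector replaced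
  by an arbitrary nonzero `A`- and translation-invariant subspace `K` (the abstract layer
  `Matrix.re_projState_ge_of_local_certificate` is already generic in `K`);
* `WardD4TorusCert` (W2's target) — instantiated at `K = nParticleSubmodule (2n)` of the `t–t'` torus with
  charges `S^±_torus` (`hamiltonian₂_commute_spinPlus/Minus` after `unfold hubbardTorusTT'`), ONE density
  multiplier on `n_{0↑}+n_{0↓}` (`N̂ = 2n` on `K`; spin balance is the Ward row
  `n_{0↑} − n_{0↓} = [S⁺_{Λ'}, c†_{0↓} c_{0↑}]`), window Ward terms transported by
  `[S^±_torus, Γ' X] = Γ' [S^±_{Λ'}, X]`;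
* `WardD4WindowSound` (W3's target) — the thermodynamic limit, as `energyDensityTT'_ge_of_window_certificate_d4`;
* `WardD4CertGe q` (W4) — a Ward × `D₄` window certificate at `(t,t',U,n) = (1,0,8,7/8)` of value `≥ q`
  EXISTS; `q = −4/5` is OPEN (record −0.8295699476, +0.0296 short), `q = −83/100` is met BY VALUE by
  CERTIFIED #529 (margin 4.3e-4; Lean content = the replay of that certificate).

`energyDensity_ge_of_wardCert` composes W1 → (W1 → W2) → (W2 → W3) → W4(q) into `q ≤ e₀(1,0,8,7/8)`
(sorry-free).  No summit statement is proved here; nothing here predicts superconductivity.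
-/

noncomputable section

namespace Summit.Ventures.CertifiedManyBodySolver.Cruxes.LowerEdge_ge_m4o5.WardK

open Matrix Finset
open Literature.MathematicalPhysics.QuantumLattice
open Literature.MathematicalPhysics.QuantumLattice.HubbardWave0
open Literature.MathematicalPhysics.QuantumLattice.ThermodynamicLimit
open Literature.Probability.LatticeModels
open Literature.MathematicalPhysics.QuantumManyBody.StateRelaxation
open scoped ComplexOrder BigOperators

/-- (As in the tree's torus certificate files.) Torus sites are compared through the linear order. -/
local instance (priority := high) instDecidableEqFermionTorusWardK {d L : ℕ} :
    DecidableEq (FermionTorus d L) := LinearOrder.toDecidableEq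

/-- Operators on the fermionic Fock space of the torus `(ℤ/Lℤ)^d`. -/
abbrev TOp (d L : ℕ) : Type :=
  Matrix (Finset (Orb (FermionTorus d L))) (Finset (Orb (FermionTorus d L))) ℂ

/-- **W1 — generic-sector translation-averaged certificate on the fermionic torus.**  The statement of
`torus_minEnergyOn_div_ge_of_local_certificate` with `szSector (2n) 0` replaced by an arbitrary
subspace `K ≠ ⊥` invariant under `A` and under the translation unitaries and their adjoints. -/
def GenericSectorTorusCert : Prop :=
  ∀ (d L : ℕ) [NeZero L] (A : TOp d L) (_hA : A.IsHermitian)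
    (K : Submodule ℂ (Fock (Orb (FermionTorus d L)))) (_hK : K ≠ ⊥)
    (_hKA : ∀ ψ ∈ K, A *ᵥ ψ ∈ K)
    (_hKT : ∀ v : TorusSite d L, ∀ ψ ∈ K, (fockTranslate v).val *ᵥ ψ ∈ K)
    (_hKT' : ∀ v : TorusSite d L, ∀ ψ ∈ K, (fockTranslate v).valᴴ *ᵥ ψ ∈ K)
    (_hAT : ∀ v : TorusSite d L, (fockTranslate v).val * A = A * (fockTranslate v).val)
    (X : TOp d L) (_hsum : ∑ v : TorusSite d L, (fockTranslate v).val * X * (fockTranslate v).valᴴ = A)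
    (δ' : Type) (dens : Finset δ') (μ ν g : δ' → ℝ) (D G : δ' → TOp d L)
    (_hD : ∀ i ∈ dens, ∑ v : TorusSite d L, (fockTranslate v).val * D i * (fockTranslate v).valᴴ = G i)
    (_hGh : ∀ i ∈ dens, (G i).IsHermitian)
    (_hG : ∀ i ∈ dens, ∀ ψ ∈ K, G i *ᵥ ψ = ((g i : ℝ) : ℂ) • ψ)
    (m : Type) (_ : Fintype m) (_ : DecidableEq m) (Λm : Matrix m m ℂ) (_hΛ : Λm.PosSemidef)
    (O : m → TOp d L)
    (κ : Type) (s : Finset κ) (Xc : κ → TOp d L)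
    (ι : Type) (tt : Finset ι) (Us Y : ι → TOp d L)
    (_hU : ∀ l ∈ tt, Us l * A = A * Us l)
    (_hUK : ∀ l ∈ tt, ∀ ψ ∈ K, Us l *ᵥ ψ ∈ K)
    (_hUK' : ∀ l ∈ tt, ∀ ψ ∈ K, (Us l)ᴴ *ᵥ ψ ∈ K)
    (_hUU : ∀ l ∈ tt, (Us l)ᴴ * Us l = 1)
    (ρ : Type) (r : Finset ρ) (Q Z Z' : ρ → TOp d L) (q : ρ → ℝ)
    (_hQh : ∀ i ∈ r, (Q i).IsHermitian)
    (_hQ : ∀ i ∈ r, ∀ ψ ∈ K, Q i *ᵥ ψ = ((q i : ℝ) : ℂ) • ψ)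
    (γ : Type) (u : Finset γ) (C W : γ → TOp d L)
    (_hC : ∀ j ∈ u, C j * A = A * C j)
    (_hCK : ∀ j ∈ u, ∀ ψ ∈ K, C j *ᵥ ψ ∈ K)
    (_hCK' : ∀ j ∈ u, ∀ ψ ∈ K, (C j)ᴴ *ᵥ ψ ∈ K)
    (δ : Type) (ah : Finset δ) (dc : δ → ℝ) (V : δ → TOp d L)
    (κ'' : Type) (w : Finset κ'') (a : κ'' → ℂ) (M : κ'' → TOp d L)
    (_hM : ∀ k ∈ w, (M k).IsContraction) (c : ℝ),
    X - (c : ℂ) • (1 : TOp d L) - ∑ i ∈ dens, ((μ i : ℝ) : ℂ) • (D i - ((ν i : ℝ) : ℂ) • (1 : TOp d L)) =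
      gramForm Λm O +
        (∑ k ∈ s, (A * Xc k - Xc k * A) +
          ∑ l ∈ tt, (Us l * Y l * (Us l)ᴴ - Y l) +
          ∑ i ∈ r, (Z i * (Q i - ((q i : ℝ) : ℂ) • 1) + (Q i - ((q i : ℝ) : ℂ) • 1) * Z' i) +
          ∑ j ∈ u, (C j * W j - W j * C j)) +
        (∑ m' ∈ ah, ((dc m' : ℝ) : ℂ) • ((V m')ᴴ - V m') + ∑ k ∈ w, a k • M k) →
    c - ∑ k ∈ w, ‖a k‖ + ∑ i ∈ dens, μ i * (g i / (L : ℝ) ^ d - ν i) ≤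
      A.minEnergyOn K / (L : ℝ) ^ d

/-- The SU(2)-Ward × affine-`D₄` window identity in `𝔄_{Λ'}` for the `t–t'` Hubbard interaction at
target density `n`, with ONE multiplier `μ` on the total site density and the two Ward null families
`Σ_r (S⁺_{Λ'} X_r − X_r S⁺_{Λ'})`, `Σ_r (S⁻_{Λ'} X'_r − X'_r S⁻_{Λ'})` added to the null terms of
`groundEnergy_hubbardTorusTT'_div_ge_of_window_certificate_d4`. -/
def WardD4Identity (t t' U n : ℝ) {Λ Λ' : Finset (Site 2)} (hΛ : Λ ⊆ Λ')
    (h0 : thicken ({0} : Finset (Site 2)) 1 ⊆ Λ') (hz : (0 : Site 2) ∈ Λ') (μ : ℝ)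
    {m : Type} [Fintype m] [DecidableEq m] (Λm : Matrix m m ℂ) (O : m → FermionOp Λ')
    {κ : Type} (s : Finset κ) (B : κ → FermionOp Λ)
    {ι : Type} (tt : Finset ι) (γ : ι → DihedralGroup 4) (wv : ι → Site 2)
    (hsh : ∀ l, d4ShiftSet (γ l) (wv l) Λ ⊆ Λ') (Y : ι → FermionOp Λ)
    {ρ : Type} (u : Finset ρ) (b : ρ → ℂ) (cw : ρ → List (Orb (PolySite Λ') × Bool))
    {θ : Type} (wp : Finset θ) (Xp : θ → FermionOp Λ')
    {θ' : Type} (wm : Finset θ') (Xm : θ' → FermionOp Λ')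
    {δ : Type} (ah : Finset δ) (dc : δ → ℝ) (V : δ → FermionOp Λ')
    {κ'' : Type} (w : Finset κ'') (a : κ'' → ℂ) (word : κ'' → List (Orb (PolySite Λ') × Bool))
    (c : ℝ) : Prop :=
  fermionEmbed (PolySite.incl h0) ((hubbardTTPrimeFermionInteraction t t' U).meanEnergyObs 1) -
      (c : ℂ) • (1 : FermionOp Λ') -
      ((μ : ℝ) : ℂ) • (nAt 0 hz 0 + nAt 0 hz 1 - ((n : ℝ) : ℂ) • (1 : FermionOp Λ')) =
    gramForm Λm O +
      (∑ k ∈ s, ((hubbardTTPrimeFermionInteraction t t' U).localHamiltonian Λ' * fermionEmbed (PolySite.incl hΛ) (B k) -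
          fermionEmbed (PolySite.incl hΛ) (B k) * (hubbardTTPrimeFermionInteraction t t' U).localHamiltonian Λ') +
        ∑ l ∈ tt, (fermionEmbed (PolySite.incl (hsh l)) (fermionEmbed (PolySite.d4Emb (γ l) (wv l) Λ) (Y l)) -
          fermionEmbed (PolySite.incl hΛ) (Y l)) +
        ∑ j ∈ u, b j • ladderWord (cw j) +
        ∑ r ∈ wp, ((spinPlus : FermionOp Λ') * Xp r - Xp r * (spinPlus : FermionOp Λ')) +
        ∑ r ∈ wm, ((spinMinus : FermionOp Λ') * Xm r - Xm r * (spinMinus : FermionOp Λ'))) +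
      (∑ m' ∈ ah, ((dc m' : ℝ) : ℂ) • ((V m')ᴴ - V m') + ∑ k ∈ w, a k • ladderWord (word k))

/-- **W2 (target) — Ward × `D₄` window certificate ⇒ energy per site of every large `t–t'` torus**,
read in the FULL `2n`-particle sector (all `S^z`), where `S^±` act. -/
def WardD4TorusCert : Prop :=
  ∀ (t t' U : ℝ) (L : ℕ) [NeZero L], 3 ≤ L →
  ∀ (nh : ℕ), nh ≤ Fintype.card (FermionTorus 2 L) →
  ∀ (n : ℝ) (Λ Λ' : Finset (Site 2)) (hΛ : Λ ⊆ Λ') (_h8 : thicken Λ 1 ⊆ Λ')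
    (h0 : thicken ({0} : Finset (Site 2)) 1 ⊆ Λ') (hz : (0 : Site 2) ∈ Λ')
    (_hInj : Set.InjOn (Torus.proj (d := 2) L) ↑(thicken Λ' 1))
    (μ : ℝ)
    (m : Type) (_ : Fintype m) (_ : DecidableEq m) (Λm : Matrix m m ℂ) (_hΛm : Λm.PosSemidef)
    (O : m → FermionOp Λ')
    (κ : Type) (s : Finset κ) (B : κ → FermionOp Λ)
    (ι : Type) (tt : Finset ι) (γ : ι → DihedralGroup 4) (wv : ι → Site 2)
    (hsh : ∀ l, d4ShiftSet (γ l) (wv l) Λ ⊆ Λ') (Y : ι → FermionOp Λ)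
    (ρ : Type) (u : Finset ρ) (b : ρ → ℂ) (cw : ρ → List (Orb (PolySite Λ') × Bool))
    (_hcw : ∀ j ∈ u, ladderCharge (cw j) ≠ 0 ∨ ladderSpinCharge (cw j) ≠ 0)
    (θ : Type) (wp : Finset θ) (Xp : θ → FermionOp Λ')
    (θ' : Type) (wm : Finset θ') (Xm : θ' → FermionOp Λ')
    (δ : Type) (ah : Finset δ) (dc : δ → ℝ) (V : δ → FermionOp Λ')
    (κ'' : Type) (w : Finset κ'') (a : κ'' → ℂ) (word : κ'' → List (Orb (PolySite Λ') × Bool))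
    (c : ℝ),
    WardD4Identity t t' U n hΛ h0 hz μ Λm O s B tt γ wv hsh Y u b cw wp Xp wm Xm ah dc V w a word c →
    c - ∑ k ∈ w, ‖a k‖ + μ * ((((2 * nh : ℕ) : ℝ)) / (L : ℝ) ^ 2 - n) ≤
      groundEnergy (hubbardTorusTT' L t t' U) (2 * nh) / (L : ℝ) ^ 2

/-- **W3 (target) — Ward × `D₄` window certificate ⇒ thermodynamic-limit energy density**
`c − Σₖ ‖aₖ‖ ≤ energyDensityTT' t t' U n` (`0 ≤ U`, `0 ≤ n < 2`, `thicken Λ 1 ⊆ Λ'`). With the two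
Ward families empty and `μ_↑ = μ_↓` this is `energyDensityTT'_ge_of_window_certificate_d4`. -/
def WardD4WindowSound : Prop :=
  ∀ (t t' U : ℝ), 0 ≤ U → ∀ (n : ℝ), 0 ≤ n → n < 2 →
  ∀ (Λ Λ' : Finset (Site 2)) (hΛ : Λ ⊆ Λ') (_h8 : thicken Λ 1 ⊆ Λ')
    (h0 : thicken ({0} : Finset (Site 2)) 1 ⊆ Λ') (hz : (0 : Site 2) ∈ Λ')
    (μ : ℝ)
    (m : Type) (_ : Fintype m) (_ : DecidableEq m) (Λm : Matrix m m ℂ) (_hΛm : Λm.PosSemidef)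
    (O : m → FermionOp Λ')
    (κ : Type) (s : Finset κ) (B : κ → FermionOp Λ)
    (ι : Type) (tt : Finset ι) (γ : ι → DihedralGroup 4) (wv : ι → Site 2)
    (hsh : ∀ l, d4ShiftSet (γ l) (wv l) Λ ⊆ Λ') (Y : ι → FermionOp Λ)
    (ρ : Type) (u : Finset ρ) (b : ρ → ℂ) (cw : ρ → List (Orb (PolySite Λ') × Bool))
    (_hcw : ∀ j ∈ u, ladderCharge (cw j) ≠ 0 ∨ ladderSpinCharge (cw j) ≠ 0)
    (θ : Type) (wp : Finset θ) (Xp : θ → FermionOp Λ')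
    (θ' : Type) (wm : Finset θ') (Xm : θ' → FermionOp Λ')
    (δ : Type) (ah : Finset δ) (dc : δ → ℝ) (V : δ → FermionOp Λ')
    (κ'' : Type) (w : Finset κ'') (a : κ'' → ℂ) (word : κ'' → List (Orb (PolySite Λ') × Bool))
    (c : ℝ),
    WardD4Identity t t' U n hΛ h0 hz μ Λm O s B tt γ wv hsh Y u b cw wp Xp wm Xm ah dc V w a word c →
    c - ∑ k ∈ w, ‖a k‖ ≤ energyDensityTT' t t' U n

/-- **W4 (the computational crux, parametrised by the bound `q`) — a Ward × `D₄` window certificate of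
value `≥ q` exists at `(t, t', U, n) = (1, 0, 8, 7/8)`**, all index sets finite ordinals (checker-friendly
normal form). -/
def WardD4CertGe (q : ℝ) : Prop :=
  ∃ (Λ Λ' : Finset (Site 2)) (hΛ : Λ ⊆ Λ') (_h8 : thicken Λ 1 ⊆ Λ')
    (h0 : thicken ({0} : Finset (Site 2)) 1 ⊆ Λ') (hz : (0 : Site 2) ∈ Λ')
    (μ : ℝ)
    (nm : ℕ) (Λm : Matrix (Fin nm) (Fin nm) ℂ) (_hΛm : Λm.PosSemidef) (O : Fin nm → FermionOp Λ')
    (ns : ℕ) (B : Fin ns → FermionOp Λ)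
    (nt : ℕ) (γ : Fin nt → DihedralGroup 4) (wv : Fin nt → Site 2)
    (hsh : ∀ l, d4ShiftSet (γ l) (wv l) Λ ⊆ Λ') (Y : Fin nt → FermionOp Λ)
    (nu : ℕ) (b : Fin nu → ℂ) (cw : Fin nu → List (Orb (PolySite Λ') × Bool))
    (_hcw : ∀ j ∈ (Finset.univ : Finset (Fin nu)), ladderCharge (cw j) ≠ 0 ∨ ladderSpinCharge (cw j) ≠ 0)
    (np : ℕ) (Xp : Fin np → FermionOp Λ') (nm' : ℕ) (Xm : Fin nm' → FermionOp Λ')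
    (na : ℕ) (dc : Fin na → ℝ) (V : Fin na → FermionOp Λ')
    (nw : ℕ) (a : Fin nw → ℂ) (word : Fin nw → List (Orb (PolySite Λ') × Bool))
    (c : ℝ),
    WardD4Identity 1 0 8 (7 / 8) hΛ h0 hz μ Λm O Finset.univ B Finset.univ γ wv hsh Y Finset.univ b cw
      Finset.univ Xp Finset.univ Xm Finset.univ dc V Finset.univ a word c ∧
    q ≤ c - ∑ k, ‖a k‖

/-- The two named instances used by the registered skeletons. -/
def WardD4Cert_m4o5 : Prop := WardD4CertGe (-4 / 5)

/-- (twin, item stmt-Ventures-22024) -/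
def WardD4Cert_m83o100 : Prop := WardD4CertGe (-83 / 100)

/-! ### Composition (sorry-free): the four statements give the real-number bound -/

/-- W1 → (W1 → W2) → (W2 → W3) → W4(q) ⇒ `q ≤ e₀(t=1, t'=0, U=8, n=7/8)`.  The conclusion is deliberately
the real inequality, not a crux decl: each skeleton file concludes ITS crux by name from this. -/
theorem energyDensity_ge_of_wardCert (q : ℝ) :
    GenericSectorTorusCert →
    (GenericSectorTorusCert → WardD4TorusCert) →
    (WardD4TorusCert → WardD4WindowSound) →
    WardD4CertGe q →
    q ≤ energyDensityTT' 1 0 8 (7 / 8) := by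
  intro h1 h2 h3 h4
  have hS : WardD4WindowSound := h3 (h2 h1)
  obtain ⟨Λ, Λ', hΛ, h8, h0, hz, μ, nm, Λm, hΛm, O, ns, B, nt, γ, wv, hsh, Y, nu, b, cw, hcw,
    np, Xp, nm', Xm, na, dc, V, nw, a, word, c, hcert, hval⟩ := h4
  have hb := hS 1 0 8 (by norm_num) (7 / 8) (by norm_num) (by norm_num) Λ Λ' hΛ h8 h0 hz μ
    (Fin nm) inferInstance inferInstance Λm hΛm O (Fin ns) Finset.univ B (Fin nt) Finset.univ γ wv hsh Y
    (Fin nu) Finset.univ b cw hcw (Fin np) Finset.univ Xp (Fin nm') Finset.univ Xm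
    (Fin na) Finset.univ dc V (Fin nw) Finset.univ a word c hcert
  linarith

end Summit.Ventures.CertifiedManyBodySolver.Cruxes.LowerEdge_ge_m4o5.WardK

end
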